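import Mathlib
import Summits.Ventures.FusionMHD.Models.CerfonFreidbergIterLikePolarPanel
import Summits.Ventures.FusionMHD.Models.CerfonFreidbergIterLikeQHalfSound
import HarnessLib

/-!
# Ventures/FusionMHD — Models/CerfonFreidbergIterLikeQHalfRay.lean: CALCULUS OF THE RAY PROFILE of THE Cerfon–Freidberg
# ITER-like flux about its magnetic axis — the radial derivative `D_r` and the second ray derivative `∂_s D_r` as closed forms
# with their `HasDerivAt` facts, and joint continuity on boxes (the analytic inputs of the certified interior `q(ψ_N = 1/2)/F`)

HONEST FRAMING (LADDER-GRIDFUSION three columns; CF rung, F2 item R2).  Pure calculus about THE flux of record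
`U = cfSolution 0 coeff`; no certificate, no `decide`.  The derivatives come from the tree's code-list machinery — model-7's
`PolarPanel.gExpr` (11-variable code list of `U(X_a + s cos θ, s sin θ) − U(X_a,0)/2`, `Models/CerfonFreidbergIterLikePolarPanel.lean`)
and Moore's derived code lists (`FExpr.pderiv`, `FExpr.hasDerivAt_eval_update`, `Literature/Analysis/ODE/CodeListMeanValueExtension.lean`)
— identified with the written-out closed forms of `Models/CerfonFreidbergIterLikeQHalfSound.lean` (`UXc`, `UYc`, `Drc`) and of this file
(`UXXc`, `UXYc`, `UYYc`, `F2c`) by `field_simp; ring`: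
* `gExpr_dom`: the code list is defined wherever `X = X_a + s cos θ > 0`;
* `dExpr_eval_eq` / `ddExpr_eval_eq`: `∂_s` and `∂_s²` of the code list ARE `Drc` and `F2c = cos²θ·U_XX + 2 cos θ sin θ·U_XY + sin²θ·U_YY`;
* **`hasDerivAt_rayProfile`**: `HasDerivAt (rayProfile U X_a 0 θ) (Drc coeff X_a s θ) s`; **`hasDerivAt_Drc`**:
  `HasDerivAt (s ↦ Drc coeff X_a s θ) (F2c coeff X_a s θ) s` (both for `X > 0`);
* `continuousOn_rayProfile_box` / `continuousOn_Drc_box`: joint continuity in `(θ, s)` on `[a, b] × [s₁, s₂]` with `0 ≤ s₁`, `s₂ < 1`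
  (so `X ≥ X_a − s₂ > 0`) — the `hF` / `hDc` hypotheses of model-7's polar-ray glue (`Models/FluxSurfacePolarRayGlue/Tube.lean`).
MODELLED: analytic Cerfon–Freidberg family; nothing about a device or stability.  Typer/prover: gridfusion-model-5 (g7), 2026-08-27.
Citations: Freidberg 2014 §6.6.1 (6.153) [Freidberg2014]; Moore 1979 §4.3 (4.21) [Moore1979].
-/

noncomputable section

open Set
open Literature.Analysis.ODE Literature.Analysis.ODE.FExpr
open Literature.MathematicalPhysics.MHD Literature.MathematicalPhysics.MHD.CerfonFreidberg
open Summit.Ventures.FusionMHD.Models.CFIterLike.PolarPanel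

namespace Summit.Ventures.FusionMHD.Models.CFIterLike.QHalf

/-! ## §1 Second partials in closed form and the second ray derivative -/

/-- `U_XX` of the `α = 0` Cerfon–Freidberg family, written out. -/
def UXXc (c : Fin 7 → ℝ) (X Y : ℝ) : ℝ :=
  ((2 : ℝ) * c 1 + ((-3) : ℝ) * c 2) + (((-2) : ℝ) * c 2) * (Real.log X) + (((-8) : ℝ) * c 3 + ((-54) : ℝ) * c 4) * Y ^ 2 + (((-24) : ℝ) * c 4) * Y ^ 2 * (Real.log X) + ((16 : ℝ) * c 5 + ((-640) : ℝ) * c 6) * Y ^ 4 + (((-240) : ℝ) * c 6) * Y ^ 4 * (Real.log X) + (((3 : ℝ) / 2) + (12 : ℝ) * c 3 + (21 : ℝ) * c 4) * X ^ 2 + ((36 : ℝ) * c 4) * X ^ 2 * (Real.log X) + (((-144) : ℝ) * c 5 + (2160 : ℝ) * c 6) * X ^ 2 * Y ^ 2 + ((2160 : ℝ) * c 6) * X ^ 2 * Y ^ 2 * (Real.log X) + ((30 : ℝ) * c 5 + ((-165) : ℝ) * c 6) * X ^ 4 + (((-450) : ℝ) * c 6) * X ^ 4 * (Real.log X)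

/-- `U_XY`. -/
def UXYc (c : Fin 7 → ℝ) (X Y : ℝ) : ℝ :=
  (((-16) : ℝ) * c 3 + ((-60) : ℝ) * c 4) * X * Y + (((-48) : ℝ) * c 4) * X * Y * (Real.log X) + ((64 : ℝ) * c 5 + ((-1600) : ℝ) * c 6) * X * Y ^ 3 + (((-960) : ℝ) * c 6) * X * Y ^ 3 * (Real.log X) + (((-96) : ℝ) * c 5 + (960 : ℝ) * c 6) * X ^ 3 * Y + ((1440 : ℝ) * c 6) * X ^ 3 * Y * (Real.log X)

/-- `U_YY`. -/
def UYYc (c : Fin 7 → ℝ) (X Y : ℝ) : ℝ :=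
  ((2 : ℝ) * c 2) + ((24 : ℝ) * c 4) * Y ^ 2 + ((240 : ℝ) * c 6) * Y ^ 4 + (((-8) : ℝ) * c 3 + ((-18) : ℝ) * c 4) * X ^ 2 + (((-24) : ℝ) * c 4) * X ^ 2 * (Real.log X) + ((96 : ℝ) * c 5 + ((-1680) : ℝ) * c 6) * X ^ 2 * Y ^ 2 + (((-1440) : ℝ) * c 6) * X ^ 2 * Y ^ 2 * (Real.log X) + (((-24) : ℝ) * c 5 + (150 : ℝ) * c 6) * X ^ 4 + ((360 : ℝ) * c 6) * X ^ 4 * (Real.log X)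

/-- **`F2c`** — the second derivative of the ray profile `s ↦ U(X_a + s cos θ, s sin θ)`, i.e. `∂_s D_r`:
`cos²θ·U_XX + 2 cos θ sin θ·U_XY + sin²θ·U_YY` at the ray point. -/
def F2c (c : Fin 7 → ℝ) (Xa s θ : ℝ) : ℝ :=
  Real.cos θ ^ 2 * UXXc c (Xa + s * Real.cos θ) (s * Real.sin θ)
    + 2 * (Real.cos θ * Real.sin θ) * UXYc c (Xa + s * Real.cos θ) (s * Real.sin θ)
    + Real.sin θ ^ 2 * UYYc c (Xa + s * Real.cos θ) (s * Real.sin θ)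

/-! ## §2 The code list's domain and its first two `s`-derivatives in closed form -/

/-- The code list `gExpr` is defined wherever `X = y₇ + y₁₀ cos y₉ > 0` (its only partial nodes are `log X`). -/
theorem gExpr_dom {y : Fin 11 → ℝ} (hX : 0 < y 7 + y 10 * Real.cos (y 9)) : gExpr.dom y := by
  simp only [gExpr, FExpr.dom, FExpr.eval, and_self, hX]

/-- `∂_s` of the code list is `Drc`. -/
theorem dExpr_eval_eq (y : Fin 11 → ℝ) : dExpr.eval y = Drc (cOf y) (y 7) (y 10) (y 9) := by
  simp only [dExpr, gExpr, FExpr.pderiv, FExpr.eval, Drc, UXc, UYc, cOf]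
  simp
  field_simp
  ring

/-- `∂_s²` of the code list is `F2c` (where `X ≠ 0`). -/
theorem ddExpr_eval_eq (y : Fin 11 → ℝ) (hX : y 7 + y 10 * Real.cos (y 9) ≠ 0) :
    (dExpr.pderiv 10).eval y = F2c (cOf y) (y 7) (y 10) (y 9) := by
  simp only [dExpr, gExpr, FExpr.pderiv, FExpr.eval, F2c, UXXc, UXYc, UYYc, cOf]
  simp
  field_simp
  ring

/-- Coordinates 7, 9, 10 of the instance point `pt θ s`. -/
theorem pt_coords (θ s : ℝ) : pt θ s 7 = Xa ∧ pt θ s 9 = θ ∧ pt θ s 10 = s := by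
  refine ⟨?_, ?_, ?_⟩ <;> simp [pt, Xa]

/-! ## §3 `HasDerivAt` along the ray -/

/-- **THE RADIAL DERIVATIVE.**  For `X = X_a + s cos θ > 0`: `HasDerivAt (rayProfile U X_a 0 θ) (Drc coeff X_a s θ) s`. -/
theorem hasDerivAt_rayProfile {θ s : ℝ} (hX : 0 < Xa + s * Real.cos θ) :
    HasDerivAt (PolarRay.rayProfile U Xa 0 θ) (Drc coeff Xa s θ) s := by
  obtain ⟨e7, e9, e10⟩ := pt_coords θ s
  have hdom : gExpr.dom (Function.update (pt θ s) 10 s) := by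
    rw [update_pt]; exact gExpr_dom (by rw [e7, e9, e10]; exact hX)
  have hd := hasDerivAt_eval_update 10 (pt θ s) gExpr hdom
  rw [update_pt] at hd
  have hfun : (fun r => gExpr.eval (Function.update (pt θ s) 10 r))
      = fun r => PolarRay.rayProfile U Xa 0 θ r - ((1 / 2) : ℝ) * U Xa 0 := by
    funext r; rw [update_pt, rayProfile_eq]; ring
  rw [hfun] at hd
  have hd' := hd.add_const (((1 / 2) : ℝ) * U Xa 0)
  simp only [sub_add_cancel] at hd'
  have hv : (gExpr.pderiv 10).eval (pt θ s) = Drc coeff Xa s θ := by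
    rw [show gExpr.pderiv 10 = dExpr from rfl, dExpr_eval_eq, cOf_pt, e7, e9, e10]
  rw [hv] at hd'
  exact hd'

/-- **THE SECOND RAY DERIVATIVE.**  For `X > 0`: `HasDerivAt (s ↦ Drc coeff X_a s θ) (F2c coeff X_a s θ) s`. -/
theorem hasDerivAt_Drc {θ s : ℝ} (hX : 0 < Xa + s * Real.cos θ) :
    HasDerivAt (fun r => Drc coeff Xa r θ) (F2c coeff Xa s θ) s := by
  obtain ⟨e7, e9, e10⟩ := pt_coords θ s
  have hdom : dExpr.dom (Function.update (pt θ s) 10 s) := by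
    rw [update_pt]; exact dom_pderiv 10 gExpr (gExpr_dom (by rw [e7, e9, e10]; exact hX))
  have hd := hasDerivAt_eval_update 10 (pt θ s) dExpr hdom
  rw [update_pt] at hd
  have hfun : (fun r => dExpr.eval (Function.update (pt θ s) 10 r)) = fun r => Drc coeff Xa r θ := by
    funext r
    obtain ⟨f7, f9, f10⟩ := pt_coords θ r
    rw [update_pt, dExpr_eval_eq, cOf_pt, f7, f9, f10]
  rw [hfun] at hd
  have hv : (dExpr.pderiv 10).eval (pt θ s) = F2c coeff Xa s θ := by
    rw [ddExpr_eval_eq _ (by rw [e7, e9, e10]; exact hX.ne'), cOf_pt, e7, e9, e10]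
  rw [hv] at hd
  exact hd

/-! ## §4 Joint continuity on boxes `[a, b] × [s₁, s₂]` with `0 ≤ s₁`, `s₂ < 1` -/

/-- On such a box `X = X_a + s cos θ > 0`. -/
theorem X_pos_of_box {θ s s₁ s₂ : ℝ} (h₁ : 0 ≤ s₁) (h₂ : s₂ < 1) (hs : s ∈ Icc s₁ s₂) : 0 < Xa + s * Real.cos θ := by
  have hXa := Xa_bounds.1
  have hc := Real.neg_one_le_cos θ
  have hs0 : 0 ≤ s := h₁.trans hs.1
  nlinarith [hs.2]

/-- The instance-point map `(θ, s) ↦ pt θ s` is continuous. -/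
theorem continuous_pt : Continuous (fun p : ℝ × ℝ => pt p.1 p.2) := by
  refine continuous_pi fun i => ?_
  by_cases hi : (i : ℕ) < 7
  · have e : (fun p : ℝ × ℝ => pt p.1 p.2 i) = fun _ => axZero ⟨i, by omega⟩ := by funext p; simp [pt, hi]
    rw [e]; exact continuous_const
  · by_cases h7 : (i : ℕ) = 7
    · have e : (fun p : ℝ × ℝ => pt p.1 p.2 i) = fun _ => axZero 8 := by funext p; simp [pt, h7]
      rw [e]; exact continuous_const
    · by_cases h8 : (i : ℕ) = 8
      · have e : (fun p : ℝ × ℝ => pt p.1 p.2 i) = fun _ => axZero 17 := by funext p; simp [pt, h8]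
        rw [e]; exact continuous_const
      · by_cases h9 : (i : ℕ) = 9
        · have e : (fun p : ℝ × ℝ => pt p.1 p.2 i) = fun p => p.1 := by funext p; simp [pt, h9]
          rw [e]; exact continuous_fst
        · have e : (fun p : ℝ × ℝ => pt p.1 p.2 i) = fun p => p.2 := by funext p; simp [pt, hi, h7, h8, h9]
          rw [e]; exact continuous_snd

/-- **Joint continuity of the ray profile** `(θ, s) ↦ U(X_a + s cos θ, s sin θ)` on `[a, b] × [s₁, s₂]`. -/
theorem continuousOn_rayProfile_box {a b s₁ s₂ : ℝ} (h₁ : 0 ≤ s₁) (h₂ : s₂ < 1) :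
    ContinuousOn (fun p : ℝ × ℝ => PolarRay.rayProfile U Xa 0 p.1 p.2) (Icc a b ×ˢ Icc s₁ s₂) := by
  have hg : ContinuousOn (fun p : ℝ × ℝ => gExpr.eval (pt p.1 p.2)) (Icc a b ×ˢ Icc s₁ s₂) := by
    refine (contDiffOn_eval gExpr).continuousOn.comp continuous_pt.continuousOn ?_
    intro p hp
    obtain ⟨e7, e9, e10⟩ := pt_coords p.1 p.2
    show gExpr.dom (pt p.1 p.2)
    exact gExpr_dom (by rw [e7, e9, e10]; exact X_pos_of_box h₁ h₂ hp.2)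
  have he : ∀ p : ℝ × ℝ, PolarRay.rayProfile U Xa 0 p.1 p.2 = gExpr.eval (pt p.1 p.2) + ((1 / 2) : ℝ) * U Xa 0 :=
    fun p => rayProfile_eq p.1 p.2
  simp_rw [he]
  exact hg.add continuousOn_const

/-- **Joint continuity of the radial-derivative field** `(θ, s) ↦ Drc coeff X_a s θ` on `[a, b] × [s₁, s₂]`. -/
theorem continuousOn_Drc_box {a b s₁ s₂ : ℝ} (h₁ : 0 ≤ s₁) (h₂ : s₂ < 1) :
    ContinuousOn (fun p : ℝ × ℝ => Drc coeff Xa p.2 p.1) (Icc a b ×ˢ Icc s₁ s₂) := by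
  have hg : ContinuousOn (fun p : ℝ × ℝ => dExpr.eval (pt p.1 p.2)) (Icc a b ×ˢ Icc s₁ s₂) := by
    refine (contDiffOn_eval dExpr).continuousOn.comp continuous_pt.continuousOn ?_
    intro p hp
    obtain ⟨e7, e9, e10⟩ := pt_coords p.1 p.2
    show dExpr.dom (pt p.1 p.2)
    exact dom_pderiv 10 gExpr (gExpr_dom (by rw [e7, e9, e10]; exact X_pos_of_box h₁ h₂ hp.2))
  have he : ∀ p : ℝ × ℝ, Drc coeff Xa p.2 p.1 = dExpr.eval (pt p.1 p.2) := by
    intro p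
    obtain ⟨e7, e9, e10⟩ := pt_coords p.1 p.2
    rw [dExpr_eval_eq, cOf_pt, e7, e9, e10]
  simp_rw [he]
  exact hg

end Summit.Ventures.FusionMHD.Models.CFIterLike.QHalf

end
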